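import Summits.BirchSwinnertonDyer.Rank1Residual.X11b.BDPRouteEndState
import Literature.NumberTheory.Automorphic.ShimuraCurveRibetTakahashiNumeratorProofs
import Literature.NumberTheory.EllipticCurves.HeegnerPointsGrossZagierProofs
import Literature.NumberTheory.EllipticCurves.ModularDegreeFormulaProofs
import HarnessLib

/-!
# Route `ErratumRoadFive`, crux `ShimuraDisplays` (item stmt-BirchSwinnertonDyer-19063) — PART 0:
# three fact-free helpers for the Shimura-curve display at `p ∥ N`

Cell `bsd-stepL` (run/shared/lean/pub/bsd-stepL/), seat `bsd-stepL-shim-p1` (prover g0),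
`--supports stmt-BirchSwinnertonDyer-19063` (route `route-BirchSwinnertonDyer-ErratumRoadFive`, crux 4 =
`Summit.BirchSwinnertonDyer.BirchSwinnertonDyer.Theses.ErratumRoadFive.ShimuraDisplays`). Helpers of the
sibling `ErratumRoadFiveShimuraUpperHalf.lean`, which re-runs the gen-11 consumer
`X11b.missingUpperBoundAt_of_classX11b_of_ram_of_not_alpha_GZR` (cell `b2b-bsdres`) on the PRINTED
Shimura-curve inputs stated over the tree's vocabulary `Literature/NumberTheory/Automorphic/ShimuraCurve.lean`:

* `isAdmissibleFactorization_prod_of_even` — an even set `S` of primes `ℓ ∥ N` gives Pasten's admissible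
  factorisation `N = (∏S)·(N/∏S)` (`IsAdmissibleFactorization`, Pasten 2024 §2 p. 12), i.e. the level of
  the Shimura curve `X_{N⁺,N⁻}`, `N⁻ = ∏S` (whose datum then exists by the tree theorem
  `nonempty_shimuraCurveData_holds`);
* `degS_mul_lDerivEK_eq_of_petersson` — Cai–Shu–Tian's display in the PRINTED Petersson normalisation
  `L′(E/K,1) = (8π²(φ,φ)/(u²√|d_K|)) · ĥ(P)/degS` converted to the covolume form
  `degS · L′(E/K,1) = (2 covol(Λ_{Dt}) deg φ_{Dt}/(c_{Dt}² u² √|d_K|)) · ĥ(P)` consumed by the kernel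
  (`gzShape₀_of_shimuraGZReal`), by Zagier's identity — the tree THEOREM
  `ModularParametrizationData.zagier_degree_formula_holds` (via `explicit_rhs_eq_of_Zagier1985`);
* `not_isOfFinAddOrder_of_petersson_display` — on an `r_an = 1` curve with `L(E^{d_K},1) ≠ 0` a point
  carrying that display is non-torsion (`L′(E/K,1) = L′(E,1)·L(E^{d_K},1) ≠ 0`, modularity; `ĥ(P) = 0 ↔ P`
  torsion, `canonicalHeight_eq_zero_iff_holds`).

No definition, no named fact, no `sorry`; nothing booked.

References: [PastenShimura2024] §2 p. 12; [CaiShuTian2014] Thm. 1.5; [ZagierCMB1985] §1.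
-/

noncomputable section

open scoped Classical

open WeierstrassCurve NumberField Literature.NumberTheory.EllipticCurves CongruenceSubgroup
  Literature.NumberTheory.EllipticCurves.ModularForms Literature.NumberTheory.Automorphic

-- the cell's Theorems namespace repeats the summit name (Summit.<Summit>.<Problem>), as in every sibling file
set_option linter.dupNamespace false

namespace Summit.BirchSwinnertonDyer.BirchSwinnertonDyer.Theorems

/-! ### The level `(∏S, N/∏S)` of `X_{N⁺,N⁻}` -/

/-- An even set `S` of primes each dividing `N > 0` exactly once gives an admissible factorisation
`N = (∏S) · (N/∏S)` (Pasten 2024 §2 p. 12: `D = ∏S` squarefree with an even number of prime factors,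
coprime to `M = N/D`). [cite: PastenShimura2024, §2 p. 12 (admissible factorization)] -/
theorem isAdmissibleFactorization_prod_of_even {N : ℕ} (hN : 0 < N) {S : Finset ℕ}
    (hS : ∀ ℓ ∈ S, ℓ.Prime ∧ ℓ ∣ N ∧ ¬ ℓ ^ 2 ∣ N) (hSe : Even S.card) :
    IsAdmissibleFactorization N (∏ q ∈ S, q) (N / ∏ q ∈ S, q) := by
  have hprime : ∀ ℓ ∈ S, ℓ.Prime := fun ℓ hℓ ↦ (hS ℓ hℓ).1
  -- `∏S ∣ N`
  have hdvd : (∏ q ∈ S, q) ∣ N :=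
    Finset.prod_primes_dvd N (fun ℓ hℓ ↦ (hprime ℓ hℓ).prime) fun ℓ hℓ ↦ (hS ℓ hℓ).2.1
  -- `ℓ · ∏S = ℓ² · ∏(S ∖ ℓ)` for `ℓ ∈ S`
  have hsplit : ∀ ℓ ∈ S, ℓ * ∏ q ∈ S, q = ℓ ^ 2 * ∏ q ∈ S.erase ℓ, q := by
    intro ℓ hℓ
    rw [← Finset.mul_prod_erase S (fun q ↦ q) hℓ]
    ring
  -- squarefree
  have hsq : Squarefree (∏ q ∈ S, q) := by
    refine Nat.squarefree_iff_prime_squarefree.mpr fun ℓ hℓ hℓ2 ↦ ?_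
    have hℓS : ℓ ∣ ∏ q ∈ S, q := dvd_trans (Dvd.intro ℓ rfl) hℓ2
    obtain ⟨q, hqS, hℓq⟩ := (Prime.dvd_finsetProd_iff hℓ.prime _).mp hℓS
    have hℓq' : ℓ = q := (Nat.prime_dvd_prime_iff_eq hℓ (hprime q hqS)).mp hℓq
    subst hℓq'
    -- `ℓ² ∣ ∏S` and `∏S ∣ N` contradict `¬ ℓ² ∣ N`
    exact (hS ℓ hqS).2.2 (dvd_trans (by simpa [sq] using hℓ2) hdvd)
  have hpf : (∏ q ∈ S, q).primeFactors = S := Nat.primeFactors_prod hprime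
  refine ⟨hN, Nat.mul_div_cancel' hdvd, hsq, by rw [hpf]; exact hSe, ?_⟩
  -- coprime to the cofactor
  refine Nat.Coprime.prod_left fun ℓ hℓ ↦ (Nat.Prime.coprime_iff_not_dvd (hprime ℓ hℓ)).mpr ?_
  intro hℓM
  apply (hS ℓ hℓ).2.2
  have h1 : ℓ * ∏ q ∈ S, q ∣ N := by
    have := Nat.mul_dvd_mul_left (∏ q ∈ S, q) hℓM
    rw [Nat.mul_div_cancel' hdvd] at this
    simpa [mul_comm] using this
  rw [hsplit ℓ hℓ] at h1
  exact dvd_trans (Dvd.intro _ rfl) h1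

/-! ### Cai–Shu–Tian's Petersson normalisation versus the kernel's covolume form -/

/-- **Petersson → covolume.** If `L′(E/K,1) = (8π²(φ,φ)_{Γ₀(N)}/((w_K/2)²√|d_K|)) · ĥ_K(P)/degS` (the
printed normalisation of Cai–Shu–Tian 2014 Thm. 1.5, `φ = Dt.f` the newform of `W`) with `degS ≥ 1`, then
`degS · L′(E/K,1) = (2 covol(Λ_{Dt}) deg φ_{Dt}/(c_{Dt}² (w_K/2)² √|d_K|)) · ĥ_K(P)` for the classical
parametrisation datum `Dt` — Zagier's identity `4π² c² (φ,φ) = deg φ · covol(Λ_E)` (tree theorem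
`zagier_degree_formula_holds`, through `explicit_rhs_eq_of_Zagier1985`). [cite: ZagierCMB1985, §1, p. 374] -/
theorem degS_mul_lDerivEK_eq_of_petersson
    (W : WeierstrassCurve ℚ) [W.IsElliptic] (N : ℕ) [NeZero N] (K : Type) [Field K] [NumberField K]
    (Dt : ModularParametrizationData W N) (P : (W.baseChange K).toAffine.Point) {degS : ℕ}
    (hdegS : 0 < degS)
    (hGZP : LDerivEK W K =
      8 * (Real.pi : ℂ) ^ 2 * peterssonProduct (Gamma0 N) 2 Dt.f Dt.f /
          ((((Units.torsionOrder K : ℝ) / 2) ^ 2 * √|(NumberField.discr K : ℝ)| : ℝ) : ℂ) *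
        ((P.canonicalHeight : ℂ) / (degS : ℂ))) :
    (degS : ℂ) * LDerivEK W K =
      ((2 * ZLattice.covolume Dt.L.lattice * (Dt.modularDegree : ℝ) /
          ((Dt.c : ℝ) ^ 2 * ((Units.torsionOrder K : ℝ) / 2) ^ 2 * √|(NumberField.discr K : ℝ)|) *
        P.canonicalHeight : ℝ) : ℂ) := by
  have hdegS0 : (degS : ℂ) ≠ 0 := by exact_mod_cast hdegS.ne'
  have hdegDt : (Dt.deg : ℂ) ≠ 0 := by exact_mod_cast Dt.deg_pos.ne'
  have hZ := explicit_rhs_eq_of_Zagier1985 (K := K) Dt Dt.zagier_degree_formula_holds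
    (P.canonicalHeight * Dt.modularDegree)
  have hmd : (Dt.modularDegree : ℂ) = (Dt.deg : ℂ) := rfl
  have h1 : (degS : ℂ) * LDerivEK W K =
      8 * (Real.pi : ℂ) ^ 2 * peterssonProduct (Gamma0 N) 2 Dt.f Dt.f /
          ((((Units.torsionOrder K : ℝ) / 2) ^ 2 * √|(NumberField.discr K : ℝ)| : ℝ) : ℂ) *
        (((P.canonicalHeight * Dt.modularDegree : ℝ) : ℂ) / (Dt.deg : ℂ)) := by
    rw [hGZP]
    push_cast
    rw [hmd]
    field_simp
  rw [h1, hZ]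
  push_cast
  ring

/-! ### A point carrying the display on an `r_an = 1` curve is non-torsion -/

/-- **Non-torsion from the display.** For `W` with `ord_{s=1} L(E,s) = 1` and a quadratic field `K`
with `L(E^{d_K},1) ≠ 0`, `L′(E/K,1) = L′(E,1) · L(E^{d_K},1) ≠ 0` (modularity, product rule); hence a
point `P ∈ E(K)` with `L′(E/K,1) = C · ĥ_K(P)/degS` is not torsion (`ĥ_K(P) = 0` for torsion `P`,
`canonicalHeight_eq_zero_iff_holds`). [folklore] -/
theorem not_isOfFinAddOrder_of_petersson_display
    (hmod : hasEntireLFunction_rat)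
    (W : WeierstrassCurve ℚ) [W.IsElliptic] (K : Type) [Field K] [NumberField K]
    (hr : W.analyticRank = 1)
    (hLt : (W.quadraticTwist (NumberField.discr K : ℚ)).entireLFunction 1 ≠ 0)
    (P : (W.baseChange K).toAffine.Point) (C d : ℂ)
    (hGZP : LDerivEK W K = C * ((P.canonicalHeight : ℂ) / d)) : ¬ IsOfFinAddOrder P := by
  haveI hEK : (W.baseChange K).IsElliptic := by rw [WeierstrassCurve.baseChange]; infer_instance
  have hL0 : W.entireLFunction 1 = 0 := entireLFunction_one_eq_zero_of_analyticRank_eq_one hr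
  obtain ⟨-, hderiv⟩ := leadingLCoeff_eq_deriv_of_analyticRank_eq_one hr
  have hLK : LDerivEK W K ≠ 0 := by
    rw [Literature.NumberTheory.EllipticCurves.KrizLi2019.lDerivEK_eq_deriv_mul W K hmod hL0]
    exact mul_ne_zero hderiv hLt
  intro htor
  have h0 : P.canonicalHeight = 0 :=
    (WeierstrassCurve.Affine.Point.canonicalHeight_eq_zero_iff_holds P).mpr htor
  apply hLK
  rw [hGZP, h0]
  simp

end Summit.BirchSwinnertonDyer.BirchSwinnertonDyer.Theorems

end
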